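import Mathlib
import HarnessLib
import Literature.AlgebraicGeometry.Resolution.QuadraticTransformsChart
import Summits.ResolutionOfSingularities.ResolutionOfSingularities.Theorems.FrobeniusClosingSteerChartRsopPart

/-!
# The maximal ideal of a local ring `B_𝔫 ⊆ K` read as fractions, and `W/y_i ⊆ 𝔫` for the monoidal chart
# (Kollár–Szabó going down, (K2-centres); crux `WildQuotients.WildQuotientResolution`, stub `stub_phaseZeroHighDim`)

Crux stmt-ResolutionOfSingularities-15640 (`WildQuotientResolution`), registered stub `stub_phaseZeroHighDim`;
programme PHASE0-KS-EIGENLINE, item (K2-centres). Toolkit for the `σ`-stability of the monoidal transform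
`S[J/y_i]_𝔫` (next file), generalising hand 8-g1's ✓`EigenlineChartFractions` from the point-blow-up chart
`blowupRing S t = S[𝔪/t]` to an ARBITRARY subring `B ⊆ K` with a prime `𝔫` (§1) and to the monoidal chart
`S[J/y_i] = Subring.closure (S ∪ {y_j/y_i})` of a centre `J = (y)` (§2):

* §1 `exists_frac_of_mem`, `mem_ofPrime_of_frac`, `frac_add/neg/sub/mul_left/mul_right`, `inv_add_mem_ofPrime`,
  `eq_zero_or_inv_not_mem_of_frac` — the maximal ideal of `B_𝔫 = LocalSubring.ofPrime B 𝔫` consists of the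
  fractions `b/s`, `b ∈ 𝔫`, `s ∉ 𝔫`; they are stable under the ring operations, a unit plus such a fraction is a
  unit, and such a fraction is a non-unit of `B_𝔫` (zero or with inverse outside);
* §2 `div_mem_closure_chart_of_mem_span` — `J/y_i ⊆ S[J/y_i]`; ★ `div_mem_centreChartOrigin_of_mem` — for an ideal
  `𝔫 ∋ y_j/y_i` (`j ≠ i`) containing `𝔪_S` and `W ≤ (y_j : j ≠ i) + 𝔪_S J` (the stable hyperplane of
  ✓`CentreEigenline.exists_generators_adapted_to_hyperplane` in adapted coordinates): `W/y_i ⊆ 𝔫`.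

[OURS · crux stmt-ResolutionOfSingularities-15640 · helper toward `stub_phaseZeroHighDim` ((K2-centres), fraction
toolkit; NOT a proof of the stub); folklore, counted 0; AI-level work, weaker than expert review.] [folklore]
-/

-- single-problem summit: the doubled namespace component `ResolutionOfSingularities` is forced
set_option linter.dupNamespace false

noncomputable section

namespace Summit.ResolutionOfSingularities.ResolutionOfSingularities.Theorems.WildQuotientResolution.CentreChart

open IsLocalRing Literature.AlgebraicGeometry.Resolution
open Summit.ResolutionOfSingularities.ResolutionOfSingularities.Theorems.SwitchingDichotomy.ChartRsop
  (le_closure_chart div_mem_closure_chart)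

universe u

/-! ## §1 The maximal ideal of `B_𝔫` read in `K`: fractions `b/s`, `b ∈ 𝔫`, `s ∉ 𝔫` -/

section MaxFractions

variable {K : Type u} [Field K] {B : Subring K} {𝔫 : Ideal B} [h𝔫 : 𝔫.IsPrime]

/-- Elements of `𝔫` are such fractions (`b/1`). [folklore] -/
theorem exists_frac_of_mem {a : B} (ha : a ∈ 𝔫) :
    ∃ b s : B, b ∈ 𝔫 ∧ s ∉ 𝔫 ∧ (a : K) = b / s :=
  ⟨a, 1, ha, fun h1 => h𝔫.ne_top ((Ideal.eq_top_iff_one _).mpr h1), by simp⟩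

/-- Such fractions lie in `B_𝔫`. [folklore] -/
theorem mem_ofPrime_of_frac {z : K} (hz : ∃ b s : B, b ∈ 𝔫 ∧ s ∉ 𝔫 ∧ z = b / s) :
    z ∈ (LocalSubring.ofPrime B 𝔫).toSubring := by
  obtain ⟨b, s, -, hs, rfl⟩ := hz
  exact mem_ofPrime_iff.mpr ⟨b, s, hs, rfl⟩

/-- Sums of such fractions are such fractions. [folklore] -/
theorem frac_add {z z' : K} (hz : ∃ b s : B, b ∈ 𝔫 ∧ s ∉ 𝔫 ∧ z = b / s)
    (hz' : ∃ b s : B, b ∈ 𝔫 ∧ s ∉ 𝔫 ∧ z' = b / s) :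
    ∃ b s : B, b ∈ 𝔫 ∧ s ∉ 𝔫 ∧ z + z' = b / s := by
  obtain ⟨b, s, hb, hs, rfl⟩ := hz
  obtain ⟨b', s', hb', hs', rfl⟩ := hz'
  refine ⟨b * s' + s * b', s * s', add_mem (𝔫.mul_mem_right _ hb) (𝔫.mul_mem_left _ hb'),
    fun h => (h𝔫.mem_or_mem h).elim hs hs', ?_⟩
  rw [div_add_div _ _ (coe_ne_zero_of_not_mem hs) (coe_ne_zero_of_not_mem hs')]
  simp only [Subring.coe_add, Subring.coe_mul]

omit h𝔫 in
/-- Negatives of such fractions are such fractions. [folklore] -/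
theorem frac_neg {z : K} (hz : ∃ b s : B, b ∈ 𝔫 ∧ s ∉ 𝔫 ∧ z = b / s) :
    ∃ b s : B, b ∈ 𝔫 ∧ s ∉ 𝔫 ∧ -z = b / s := by
  obtain ⟨b, s, hb, hs, rfl⟩ := hz
  exact ⟨-b, s, neg_mem hb, hs, by rw [Subring.coe_neg, neg_div]⟩

/-- Differences of such fractions are such fractions. [folklore] -/
theorem frac_sub {z z' : K} (hz : ∃ b s : B, b ∈ 𝔫 ∧ s ∉ 𝔫 ∧ z = b / s)
    (hz' : ∃ b s : B, b ∈ 𝔫 ∧ s ∉ 𝔫 ∧ z' = b / s) :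
    ∃ b s : B, b ∈ 𝔫 ∧ s ∉ 𝔫 ∧ z - z' = b / s := by
  rw [sub_eq_add_neg]
  exact frac_add hz (frac_neg hz')

/-- Multiples of such fractions by elements of `B_𝔫` are such fractions. [folklore] -/
theorem frac_mul_left {w z : K} (hw : w ∈ (LocalSubring.ofPrime B 𝔫).toSubring)
    (hz : ∃ b s : B, b ∈ 𝔫 ∧ s ∉ 𝔫 ∧ z = b / s) :
    ∃ b s : B, b ∈ 𝔫 ∧ s ∉ 𝔫 ∧ w * z = b / s := by
  obtain ⟨b, s, hb, hs, rfl⟩ := hz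
  obtain ⟨a, s', hs', rfl⟩ := mem_ofPrime_iff.mp hw
  refine ⟨a * b, s' * s, 𝔫.mul_mem_left _ hb, fun h => (h𝔫.mem_or_mem h).elim hs' hs, ?_⟩
  rw [div_mul_div_comm, Subring.coe_mul, Subring.coe_mul]

/-- … and on the right. [folklore] -/
theorem frac_mul_right {w z : K} (hz : ∃ b s : B, b ∈ 𝔫 ∧ s ∉ 𝔫 ∧ z = b / s)
    (hw : w ∈ (LocalSubring.ofPrime B 𝔫).toSubring) :
    ∃ b s : B, b ∈ 𝔫 ∧ s ∉ 𝔫 ∧ z * w = b / s := by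
  rw [mul_comm]; exact frac_mul_left hw hz

/-- **A unit plus such a fraction is a unit of `B_𝔫`.** [folklore] -/
theorem inv_add_mem_ofPrime {c : B} (hc : c ∉ 𝔫) {z : K}
    (hz : ∃ b s : B, b ∈ 𝔫 ∧ s ∉ 𝔫 ∧ z = b / s) :
    ((c : K) + z)⁻¹ ∈ (LocalSubring.ofPrime B 𝔫).toSubring := by
  obtain ⟨b, s, hb, hs, rfl⟩ := hz
  have hs0 : ((s : B) : K) ≠ 0 := coe_ne_zero_of_not_mem hs
  have hcs : c * s + b ∉ 𝔫 := fun h => by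
    have h' : c * s ∈ 𝔫 := by simpa using 𝔫.sub_mem h hb
    exact (h𝔫.mem_or_mem h').elim hc hs
  refine mem_ofPrime_iff.mpr ⟨s, c * s + b, hcs, ?_⟩
  have e : (c : K) + (b : K) / (s : K) = ((c * s + b : B) : K) / (s : K) := by
    rw [Subring.coe_add, Subring.coe_mul]
    field_simp
  rw [e, inv_div]

/-- **Such fractions are non-units of `B_𝔫`**: zero, or with inverse outside. [folklore] -/
theorem eq_zero_or_inv_not_mem_of_frac {z : K} (hz : ∃ b s : B, b ∈ 𝔫 ∧ s ∉ 𝔫 ∧ z = b / s) :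
    z = 0 ∨ z⁻¹ ∉ (LocalSubring.ofPrime B 𝔫).toSubring := by
  obtain ⟨b, s, hb, hs, rfl⟩ := hz
  by_cases hb0 : ((b : B) : K) = 0
  · exact Or.inl (by rw [hb0, zero_div])
  refine Or.inr fun hinv => ?_
  obtain ⟨a, s', hs', has⟩ := mem_ofPrime_iff.mp hinv
  have hs0 : ((s : B) : K) ≠ 0 := coe_ne_zero_of_not_mem hs
  have hs'0 : ((s' : B) : K) ≠ 0 := coe_ne_zero_of_not_mem hs'
  rw [inv_div, div_eq_div_iff hb0 hs'0] at has
  have h : s * s' = a * b := Subtype.ext (by simpa [Subring.coe_mul] using has)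
  exact (h𝔫.mem_or_mem (h ▸ 𝔫.mul_mem_left a hb)).elim hs hs'

omit h𝔫 in
/-- A fraction `b/s` (`b, s ∈ B`) whose NUMERATOR is not in `𝔫` has its inverse in `B_𝔫`. [folklore] -/
theorem inv_mem_ofPrime_of_not_mem [𝔫.IsPrime] {b : B} (s : B) (hb : b ∉ 𝔫) :
    ((b : K) / (s : K))⁻¹ ∈ (LocalSubring.ofPrime B 𝔫).toSubring := by
  rw [inv_div]
  exact mem_ofPrime_iff.mpr ⟨s, b, hb, rfl⟩

end MaxFractions

/-! ## §2 The monoidal chart `S[J/y_i]`: `J/y_i ⊆ S[J/y_i]` and `W/y_i ⊆ 𝔫` -/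

section Chart

variable {K : Type u} [Field K]

/-- **`J/y_i ⊆ S[J/y_i]`**: for `c ∈ J = (y)`, `c/y_i` lies in the chart ring `Subring.closure (S ∪ {y_j/y_i})`.
[folklore] -/
theorem div_mem_closure_chart_of_mem_span (S : Subring K) {r : ℕ} (y : Fin r → S) (i : Fin r) {c : S}
    (hc : c ∈ Ideal.span (Set.range y)) :
    (c : K) / ((y i : S) : K) ∈
      Subring.closure ((S : Set K) ∪ Set.range fun j => ((y j : S) : K) / ((y i : S) : K)) := by
  induction hc using Submodule.span_induction with
  | mem c hc =>
    obtain ⟨j, rfl⟩ := hc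
    exact div_mem_closure_chart S y i j
  | zero =>
    rw [ZeroMemClass.coe_zero, zero_div]
    exact Subring.zero_mem _
  | add a b _ _ ha hb =>
    rw [AddMemClass.coe_add, add_div]
    exact add_mem ha hb
  | smul a c _ hc =>
    rw [smul_eq_mul, MulMemClass.coe_mul, mul_div_assoc]
    exact mul_mem (le_closure_chart S y i a.2) hc

/-- **`W/y_i ⊆ 𝔫`.** Let `S ≤ B ⊆ K` be subrings, `S` local, `y` a family in `S` with `J/y_i ⊆ B` (`J = (y)`; e.g.
`B = S[J/y_i]`, `div_mem_closure_chart_of_mem_span`), and `𝔫` an ideal of `B` containing the `y_j/y_i` (`j ≠ i`) and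
(the image of) `𝔪_S` — e.g. the chart origin ✓`CentreChart.exists_centreChartOrigin`. Then for every ideal
`W ≤ (y_j : j ≠ i) + 𝔪_S·J` (the stable hyperplane in adapted coordinates,
✓`CentreEigenline.exists_generators_adapted_to_hyperplane`) and every `w ∈ W`: `w/y_i ∈ 𝔫`. (Linear part:
`y_j/y_i ∈ 𝔫`; `𝔪J`-part: `(m c)/y_i = m · (c/y_i)` with `m ∈ 𝔫`.) Stated proof-irrelevantly in the membership
`hB`; hand 8-g1's ✓`EigenlineChart.div_mem_chartOrigin_of_mem` is the case `J = 𝔪`, `B = S[𝔪/t]`. [folklore] -/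
theorem div_mem_centreChartOrigin_of_mem (S B : Subring K) [IsLocalRing S] (hSB : S ≤ B) {r : ℕ}
    (y : Fin r → S) (i : Fin r)
    (hJB : ∀ c : S, c ∈ Ideal.span (Set.range y) → (c : K) / ((y i : S) : K) ∈ B)
    (𝔫 : Ideal B)
    (hnj : ∀ j : Fin r, j ≠ i → ∀ hB : ((y j : S) : K) / ((y i : S) : K) ∈ B, (⟨_, hB⟩ : B) ∈ 𝔫)
    (hover : ∀ s : S, s ∈ maximalIdeal S → (⟨(s : K), hSB s.2⟩ : B) ∈ 𝔫)
    {W : Ideal S} (hWle : W ≤ Ideal.span (y '' {j | j ≠ i}) ⊔ maximalIdeal S * Ideal.span (Set.range y))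
    {w : S} (hw : w ∈ W) (hB : (w : K) / ((y i : S) : K) ∈ B) :
    (⟨(w : K) / ((y i : S) : K), hB⟩ : B) ∈ 𝔫 := by
  -- adapted from hand 8-g1's `EigenlineChart.div_mem_chartOrigin_of_mem` (`𝔪² ↦ 𝔪J`, `S[𝔪/t] ↦ B ⊇ S[J/y_i]`)
  classical
  have hyJ : ∀ j, y j ∈ Ideal.span (Set.range y) := fun j => Ideal.subset_span ⟨j, rfl⟩
  -- the property `v/y_i ∈ 𝔫`, in proof-irrelevant form, and its closure properties
  have hPzero : ∃ hB : ((0 : S) : K) / ((y i : S) : K) ∈ B, (⟨_, hB⟩ : B) ∈ 𝔫 := by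
    have h0 : ((0 : S) : K) / ((y i : S) : K) = 0 := by rw [ZeroMemClass.coe_zero, zero_div]
    refine ⟨by rw [h0]; exact Subring.zero_mem _, ?_⟩
    have e : (⟨((0 : S) : K) / ((y i : S) : K), by rw [h0]; exact Subring.zero_mem _⟩ : B) = 0 :=
      Subtype.ext h0
    rw [e]; exact 𝔫.zero_mem
  have hPadd : ∀ v z : S,
      (∃ hB : (v : K) / ((y i : S) : K) ∈ B, (⟨_, hB⟩ : B) ∈ 𝔫) →
      (∃ hB : (z : K) / ((y i : S) : K) ∈ B, (⟨_, hB⟩ : B) ∈ 𝔫) →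
      ∃ hB : ((v + z : S) : K) / ((y i : S) : K) ∈ B, (⟨_, hB⟩ : B) ∈ 𝔫 := by
    intro v z ⟨hvB, hv⟩ ⟨hzB, hz⟩
    have e0 : ((v + z : S) : K) / ((y i : S) : K) =
        (v : K) / ((y i : S) : K) + (z : K) / ((y i : S) : K) := by
      rw [AddMemClass.coe_add, add_div]
    refine ⟨by rw [e0]; exact add_mem hvB hzB, ?_⟩
    have e : (⟨((v + z : S) : K) / ((y i : S) : K), by rw [e0]; exact add_mem hvB hzB⟩ : B) =
        ⟨_, hvB⟩ + ⟨_, hzB⟩ := Subtype.ext e0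
    rw [e]; exact add_mem hv hz
  have hPmul : ∀ a v : S,
      (∃ hB : (v : K) / ((y i : S) : K) ∈ B, (⟨_, hB⟩ : B) ∈ 𝔫) →
      ∃ hB : ((a * v : S) : K) / ((y i : S) : K) ∈ B, (⟨_, hB⟩ : B) ∈ 𝔫 := by
    intro a v ⟨hvB, hv⟩
    have haB : (a : K) ∈ B := hSB a.2
    have e0 : ((a * v : S) : K) / ((y i : S) : K) = (a : K) * ((v : K) / ((y i : S) : K)) := by
      rw [MulMemClass.coe_mul, mul_div_assoc]
    refine ⟨by rw [e0]; exact mul_mem haB hvB, ?_⟩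
    have e : (⟨((a * v : S) : K) / ((y i : S) : K), by rw [e0]; exact mul_mem haB hvB⟩ : B) =
        ⟨_, haB⟩ * ⟨_, hvB⟩ := Subtype.ext e0
    rw [e]; exact 𝔫.mul_mem_left _ hv
  -- the linear part `(y_j : j ≠ i)/y_i ⊆ 𝔫`
  have h₁ : ∀ v ∈ Ideal.span (y '' {j | j ≠ i}),
      ∃ hB : (v : K) / ((y i : S) : K) ∈ B, (⟨_, hB⟩ : B) ∈ 𝔫 := by
    intro v hv
    induction hv using Submodule.span_induction with
    | mem v hv =>
      obtain ⟨j, hj, rfl⟩ := hv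
      exact ⟨hJB _ (hyJ j), hnj j hj _⟩
    | zero => exact hPzero
    | add v z _ _ hv hz => exact hPadd v z hv hz
    | smul a v _ hv => exact hPmul a v hv
  -- the part `𝔪J/y_i = 𝔪 · (J/y_i) ⊆ 𝔫`
  have h₂ : ∀ m ∈ maximalIdeal S * Ideal.span (Set.range y),
      ∃ hB : (m : K) / ((y i : S) : K) ∈ B, (⟨_, hB⟩ : B) ∈ 𝔫 := by
    intro m hm
    refine Submodule.mul_induction_on hm (fun a ha c hc => ?_) (fun v z hv hz => hPadd v z hv hz)
    have haB : (a : K) ∈ B := hSB a.2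
    have hcB := hJB c hc
    have e0 : ((a * c : S) : K) / ((y i : S) : K) = (a : K) * ((c : K) / ((y i : S) : K)) := by
      rw [MulMemClass.coe_mul, mul_div_assoc]
    refine ⟨by rw [e0]; exact mul_mem haB hcB, ?_⟩
    have e : (⟨((a * c : S) : K) / ((y i : S) : K), by rw [e0]; exact mul_mem haB hcB⟩ : B) =
        ⟨_, haB⟩ * ⟨_, hcB⟩ := Subtype.ext e0
    rw [e]; exact 𝔫.mul_mem_right _ (hover a ha)
  obtain ⟨w₁, hw₁, m, hm, hwm⟩ := Submodule.mem_sup.mp (hWle hw)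
  subst hwm
  obtain ⟨hB', h'⟩ := hPadd w₁ m (h₁ w₁ hw₁) (h₂ m hm)
  exact h'

/-- An ideal `W ≤ (y_j : j ≠ i) + 𝔪J` lies in `J = (y)`. [folklore] -/
theorem le_span_of_le_hyperplane (S : Subring K) [IsLocalRing S] {r : ℕ} (y : Fin r → S) (i : Fin r)
    {W : Ideal S} (hWle : W ≤ Ideal.span (y '' {j | j ≠ i}) ⊔ maximalIdeal S * Ideal.span (Set.range y)) :
    W ≤ Ideal.span (Set.range y) :=
  hWle.trans (sup_le (Ideal.span_mono (Set.image_subset_range _ _)) Ideal.mul_le_left)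

end Chart

end Summit.ResolutionOfSingularities.ResolutionOfSingularities.Theorems.WildQuotientResolution.CentreChart

end
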